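import Literature.NumberTheory.LFunctions.YoshidaWindowFourierDecay
import Mathlib.Analysis.Fourier.AddCircle
import Mathlib.Analysis.PSeries
import HarnessLib

/-!
# Fourier series on Yoshida's window: decay, pointwise inversion, uniform approximation

Window vocabulary of `Literature/NumberTheory/LFunctions/YoshidaWindowSpaces.lean` (H. Yoshida, *On
Hermitian forms attached to zeta functions*, Adv. Stud. Pure Math. 21 (1992), §2–3: the spaces
`C(a) ⊂ K(a)`, the basis `χ_n = chi a n = (2a)^{-1/2} e^{iπnx/a} 𝟙_{[-a,a]}`, the window Fourier
coefficients `c_n(φ) = fourierCoeff a n φ = ∫_{-a}^{a} φ(x) e^{-iπnx/a} dx`, `modes N = {|n| ≤ N}`,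
the truncated Fourier series `proj a N φ = Σ_{|n| ≤ N} (2a)^{-1/2} c_n χ_n`, and the decay (3.1) of
`YoshidaWindowFourierDecay.lean`).

## Contents (everything PROVED; no named facts)

* `summable_pow_mul_norm_fourierCoeff`: `Σ_n |n|^j |c_n(φ)| < ∞` for `φ ∈ K(a)` (from Yoshida's (3.1),
  `norm_fourierCoeff_le_of_mem_K` of `YoshidaWindowFourierDecay.lean`).
* `proj a N φ = 𝟙_{[-a,a]} · p_N` with the trigonometric polynomial
  `p_N = trigPoly a N φ = Σ_{|n| ≤ N} (2a)^{-1} c_n e^{iπnx/a}` (`proj_apply_eq_indicator_trigPoly`).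
* **Pointwise Fourier inversion on the closed window** (`hasSum_fourierCoeff_mul_cexp`):
  `Σ_{n ∈ ℤ} (2a)^{-1} c_n(φ) e^{iπnx/a} = φ(x)` for `|x| ≤ a` and every `φ ∈ K(a)` — Yoshida's
  "Fourier expansion `φ = Σ c_n χ_n`, `|x| ≤ a`" (p. 289), via Mathlib's
  `has_pointwise_sum_fourier_series_of_summable` on `AddCircle (2a)` applied to the smooth
  `2a`-periodic function extending `φ`.
* Uniform approximation `‖φ(x) − p_N(x)‖ ≤ Σ_{|n| > N} (2a)^{-1}|c_n|` on the window
  (`norm_sub_trigPoly_le`), with the tails tending to `0` (`tendsto_tsum_compl_modes`), and the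
  uniform bounds `‖p_N‖ ≤ Σ (2a)^{-1}|c_n|`, `‖p_N'‖ ≤ (π/a)(2a)^{-1} Σ |n||c_n|`, whence the
  `N`-uniform Lipschitz bound `‖p_N(y) − p_N(x)‖ ≤ B₁|y − x|` (`norm_trigPoly_sub_le`).

These are the inputs of the format-C dictionary (continuity of Weil's window form along
`proj a N φ → φ`, `Summits/RiemannHypothesis/RiemannHypothesis/Theorems/WeilFormatCWindow*.lean`).
Nothing here is specific to Weil's functional; the convergence statements are the textbook facts of
Y. Katznelson, *An Introduction to Harmonic Analysis* (3rd ed., 2004), Ch. I (Thm 1.6, §6.1: absolutely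
convergent Fourier series converge uniformly to the function), transported from `𝕋 = ℝ/2πℤ` to the
window `[-a, a]` (period `2a`).
-/

set_option autoImplicit false

noncomputable section

open Complex Filter Set MeasureTheory
open scoped Real Topology ComplexConjugate ContDiff

namespace Literature.NumberTheory.LFunctions

open _root_.MeasureTheory _root_.Topology

namespace Yoshida1992

/-! ## §2 Summability of the window Fourier coefficients on `K(a)` -/

variable {a : ℝ} {φ : ℝ → ℂ}

/-- The character `x ↦ e^{iπnx/a}` has norm one. [folklore] -/
private theorem norm_cexp_window_pos (a : ℝ) (n : ℤ) (x : ℝ) :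
    ‖cexp (π * I * n * x / a)‖ = 1 := by
  have : (π * I * n * x / a : ℂ) = ((π * n * x / a : ℝ) : ℂ) * I := by
    push_cast
    ring
  rw [this, Complex.norm_exp_ofReal_mul_I]

/-- Summability of `|n|^j |c_n(φ)|` (`j = 0, 1, …`) for `φ ∈ K(a)`, `a > 0` — from Yoshida's (3.1)
`|c_n| ≤ C_k/|n|^k` (`norm_fourierCoeff_le_of_mem_K`) with `k = j + 2`.
[cite: Yoshida1992HermitianForms, §3 p. 289–290, (3.1)] -/
theorem summable_pow_mul_norm_fourierCoeff (ha : 0 < a) (hφ : φ ∈ K a) (j : ℕ) :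
    Summable fun n : ℤ ↦ |(n : ℝ)| ^ j * ‖fourierCoeff a n φ‖ := by
  obtain ⟨C, hC0, hC⟩ := norm_fourierCoeff_le_of_mem_K ha hφ (j + 2)
  have hs : Summable fun n : ℤ ↦ C * (1 / (n : ℝ) ^ 2) :=
    (Real.summable_one_div_int_pow.2 one_lt_two).mul_left C
  refine Summable.of_norm_bounded_eventually (hs.abs) ?_
  have hcof : ∀ᶠ n : ℤ in cofinite, n ≠ 0 := by
    simpa using (Set.finite_singleton (0 : ℤ)).eventually_cofinite_notMem
  filter_upwards [hcof] with n hn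
  have hn' : 0 < |(n : ℝ)| := abs_pos.2 (by exact_mod_cast hn)
  rw [Real.norm_of_nonneg (by positivity)]
  calc |(n : ℝ)| ^ j * ‖fourierCoeff a n φ‖ ≤ |(n : ℝ)| ^ j * (C / |(n : ℝ)| ^ (j + 2)) :=
        mul_le_mul_of_nonneg_left (hC n hn) (by positivity)
    _ = C * (1 / (n : ℝ) ^ 2) := by
        rw [pow_add, ← sq_abs (n : ℝ)]
        field_simp
    _ ≤ |C * (1 / (n : ℝ) ^ 2)| := le_abs_self _

/-- The window Fourier coefficients of `φ ∈ K(a)` are absolutely summable (`a > 0`).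
[cite: Yoshida1992HermitianForms, §3 p. 289–290, (3.1)] -/
theorem summable_norm_fourierCoeff (ha : 0 < a) (hφ : φ ∈ K a) :
    Summable fun n : ℤ ↦ ‖fourierCoeff a n φ‖ := by
  simpa using summable_pow_mul_norm_fourierCoeff ha hφ 0

/-! ## §3 Fourier inversion on the closed window and the truncated Fourier series -/

/-- The trigonometric-polynomial core of the truncated Fourier series of `φ` on `[-a, a]`:
`p_N(x) = Σ_{|n| ≤ N} (2a)^{-1} c_n(φ) e^{iπnx/a}` (a smooth `2a`-periodic function on all of `ℝ`;
`proj a N φ = 𝟙_{[-a,a]} · p_N`, `proj_apply_eq_indicator_trigPoly`).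
[cite: Yoshida1992HermitianForms, §3 p. 289 (Fourier expansion on K(a))] -/
def trigPoly (a : ℝ) (N : ℕ) (φ : ℝ → ℂ) (x : ℝ) : ℂ :=
  ∑ n ∈ modes N, fourierCoeff a n φ / (2 * a) * cexp (π * I * n * x / a)

/-- The formal derivative of `trigPoly a N φ`:
`p_N'(x) = Σ_{|n| ≤ N} (2a)^{-1} c_n(φ) (iπn/a) e^{iπnx/a}`. [folklore] -/
def trigPolyDeriv (a : ℝ) (N : ℕ) (φ : ℝ → ℂ) (x : ℝ) : ℂ :=
  ∑ n ∈ modes N, fourierCoeff a n φ / (2 * a) * (π * I * n / a) * cexp (π * I * n * x / a)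

/-- `(2a)^{-1/2} · (2a)^{-1/2} = (2a)^{-1}` in `ℂ` (`a > 0`). [folklore] -/
private theorem inv_sqrt_mul_inv_sqrt (ha : 0 < a) :
    ((1 / Real.sqrt (2 * a) : ℝ) : ℂ) * ((1 / Real.sqrt (2 * a) : ℝ) : ℂ) = 1 / (2 * a) := by
  rw [← Complex.ofReal_mul]
  have h : (1 / Real.sqrt (2 * a)) * (1 / Real.sqrt (2 * a)) = 1 / (2 * a) := by
    rw [div_mul_div_comm, one_mul, Real.mul_self_sqrt (by positivity)]
  rw [h]
  push_cast
  ring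

/-- The truncated Fourier series is the trigonometric polynomial `p_N` cut off at the window:
`proj a N φ x = 𝟙_{[-a,a]}(x) · p_N(x)`. [cite: Yoshida1992HermitianForms, §3 p. 289 (Fourier expansion on K(a))] -/
theorem proj_apply_eq_indicator_trigPoly (ha : 0 < a) (N : ℕ) (φ : ℝ → ℂ) (x : ℝ) :
    proj a N φ x = (Icc (-a) a).indicator (trigPoly a N φ) x := by
  unfold proj trigPoly
  rw [Finset.sum_apply]
  by_cases hx : x ∈ Icc (-a) a
  · rw [indicator_of_mem hx]
    refine Finset.sum_congr rfl fun n _ ↦ ?_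
    rw [Pi.smul_apply, smul_eq_mul, chi, indicator_of_mem hx, chiCore]
    calc (((1 / Real.sqrt (2 * a) : ℝ) : ℂ) * fourierCoeff a n φ) *
          ((((1 / Real.sqrt (2 * a) : ℝ)) : ℂ) * cexp (π * I * n * x / a))
        = (((1 / Real.sqrt (2 * a) : ℝ) : ℂ) * ((1 / Real.sqrt (2 * a) : ℝ) : ℂ)) *
            fourierCoeff a n φ * cexp (π * I * n * x / a) := by ring
      _ = fourierCoeff a n φ / (2 * a) * cexp (π * I * n * x / a) := by
          rw [inv_sqrt_mul_inv_sqrt ha]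
          ring
  · rw [indicator_of_notMem hx]
    refine Finset.sum_eq_zero fun n _ ↦ ?_
    rw [Pi.smul_apply, smul_eq_mul, chi, indicator_of_notMem hx, mul_zero]

/-- Outside the closed window the truncated Fourier series vanishes. [cite: Yoshida1992HermitianForms, §3 p. 289] -/
theorem proj_apply_of_not_mem (ha : 0 < a) (N : ℕ) (φ : ℝ → ℂ) {x : ℝ} (hx : x ∉ Icc (-a) a) :
    proj a N φ x = 0 := by
  rw [proj_apply_eq_indicator_trigPoly ha, indicator_of_notMem hx]

/-- Inside the closed window the truncated Fourier series is `p_N`. [cite: Yoshida1992HermitianForms, §3 p. 289] -/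
theorem proj_apply_of_mem (ha : 0 < a) (N : ℕ) (φ : ℝ → ℂ) {x : ℝ} (hx : x ∈ Icc (-a) a) :
    proj a N φ x = trigPoly a N φ x := by
  rw [proj_apply_eq_indicator_trigPoly ha, indicator_of_mem hx]

/-- **Fourier inversion on the closed window.** For `φ ∈ K(a)` (`a > 0`; `φ = f` on `[-a, a]`
for a smooth `2a`-periodic `f`, `φ = 0` outside):
`Σ_{n ∈ ℤ} (2a)^{-1} c_n(φ) e^{iπnx/a} = φ(x)` for every `|x| ≤ a` — Yoshida's "Fourier expansion
`φ(x) = Σ c_n χ_n(x)`, `|x| ≤ a`" (p. 289), here via Mathlib's pointwise Fourier inversion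
(`has_pointwise_sum_fourier_series_of_summable`) for the continuous `2a`-periodic function `f` on
`AddCircle (2a)`, whose Fourier coefficients are absolutely summable by (3.1).
[cite: Yoshida1992HermitianForms, §3 p. 289 (Fourier expansion on K(a))] -/
theorem hasSum_fourierCoeff_mul_cexp (ha : 0 < a) (hφ : φ ∈ K a) {x : ℝ} (hx : x ∈ Icc (-a) a) :
    HasSum (fun n : ℤ ↦ fourierCoeff a n φ / (2 * a) * cexp (π * I * n * x / a)) (φ x) := by
  haveI hT : Fact (0 < 2 * a) := ⟨by positivity⟩
  have hsum : Summable fun n : ℤ ↦ ‖fourierCoeff a n φ‖ := summable_norm_fourierCoeff ha hφ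
  obtain ⟨f, hf, hper, hφf, -⟩ := hφ
  have hfa : f (-a) = f (-a + 2 * a) := (hper (-a)).symm
  -- the continuous `2a`-periodic function `f` on the circle
  let F : C(AddCircle (2 * a), ℂ) :=
    ⟨AddCircle.liftIco (2 * a) (-a) f, AddCircle.liftIco_continuous hfa hf.continuous.continuousOn⟩
  have hF : ∀ y ∈ Icc (-a) a, F (y : AddCircle (2 * a)) = φ y := by
    intro y hy
    rw [hφf y (abs_le.2 ⟨hy.1, hy.2⟩)]
    rcases eq_or_lt_of_le hy.2 with heq | hlt
    · -- `y = a`: on the circle `a = -a + 2a ≡ -a`, and `f(-a) = f(a)` by periodicity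
      rw [heq]
      have e : ((a : ℝ) : AddCircle (2 * a)) = ((-a : ℝ) : AddCircle (2 * a)) := by
        have h := AddCircle.coe_add_period (2 * a) (-a)
        rwa [show -a + 2 * a = a by ring] at h
      show AddCircle.liftIco (2 * a) (-a) f (a : AddCircle (2 * a)) = f a
      rw [e, AddCircle.liftIco_coe_apply ⟨le_rfl, by linarith⟩, hfa, show -a + 2 * a = a by ring]
    · show AddCircle.liftIco (2 * a) (-a) f (y : AddCircle (2 * a)) = f y
      exact AddCircle.liftIco_coe_apply ⟨hy.1, by linarith⟩
  -- its Fourier coefficients are `(2a)^{-1} c_n(φ)`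
  have hcoef : ∀ n : ℤ, _root_.fourierCoeff (F : AddCircle (2 * a) → ℂ) n =
      fourierCoeff a n φ / (2 * a) := by
    intro n
    rw [fourierCoeff_eq_intervalIntegral _ n (-a), show -a + 2 * a = a by ring]
    have hint : ∫ y in (-a)..a, (fourier (-n)) (y : AddCircle (2 * a)) • F (y : AddCircle (2 * a))
        = ∫ y in (-a)..a, φ y * cexp (-(π * I * n * y / a)) := by
      refine intervalIntegral.integral_congr fun y hy ↦ ?_
      rw [uIcc_of_le (by linarith)] at hy
      rw [smul_eq_mul, hF y hy, fourier_coe_apply, mul_comm]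
      congr 1
      congr 1
      push_cast
      field_simp
    rw [hint, fourierCoeff]
    rw [Complex.real_smul]
    push_cast
    ring
  have hsumF : Summable (_root_.fourierCoeff (F : AddCircle (2 * a) → ℂ)) := by
    refine Summable.of_norm ?_
    simp_rw [hcoef, norm_div]
    have : ‖((2 : ℂ) * a)‖ = 2 * a := by
      rw [show ((2 : ℂ) * a) = ((2 * a : ℝ) : ℂ) by push_cast; ring, Complex.norm_real,
        Real.norm_of_nonneg (by positivity)]
    simp_rw [this]
    exact hsum.div_const _
  have hpt := has_pointwise_sum_fourier_series_of_summable hsumF (x : AddCircle (2 * a))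
  rw [hF x hx] at hpt
  convert hpt using 1
  ext n
  rw [hcoef, fourier_coe_apply, smul_eq_mul]
  congr 1
  congr 1
  push_cast
  field_simp

/-- The index sets `modes N = {|n| ≤ N}` exhaust `ℤ`. [folklore] -/
private theorem tendsto_modes_atTop : Tendsto modes atTop atTop := by
  refine Monotone.tendsto_atTop_atTop (fun M N h ↦ ?_) fun s ↦ ?_
  · intro n hn
    rw [mem_modes] at hn ⊢
    exact hn.trans (by exact_mod_cast h)
  · refine ⟨(s.sup fun n ↦ n.natAbs), fun n hn ↦ mem_modes.2 ?_⟩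
    have h := Finset.le_sup (f := fun n : ℤ ↦ n.natAbs) hn
    rw [← Int.natCast_natAbs]
    exact_mod_cast h

/-- **Uniform approximation by the truncated Fourier series**: for `|x| ≤ a`,
`‖φ(x) − p_N(x)‖ ≤ Σ_{|n| > N} (2a)^{-1} |c_n(φ)|`. [cite: Katznelson2004, Ch. I §6.1 (uniform convergence of absolutely convergent Fourier series)] -/
theorem norm_sub_trigPoly_le (ha : 0 < a) (hφ : φ ∈ K a) (N : ℕ) {x : ℝ} (hx : x ∈ Icc (-a) a) :
    ‖φ x - trigPoly a N φ x‖ ≤ ∑' n : {n // n ∉ modes N}, ‖fourierCoeff a n φ‖ / (2 * a) := by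
  have hsum : Summable fun n : ℤ ↦ ‖fourierCoeff a n φ‖ := summable_norm_fourierCoeff ha hφ
  have hf := hasSum_fourierCoeff_mul_cexp ha hφ hx
  have hcompl := ((modes N).hasSum_iff_compl).1 hf
  have hnorm : ∀ n : ℤ, ‖fourierCoeff a n φ / (2 * a) * cexp (π * I * n * x / a)‖ =
      ‖fourierCoeff a n φ‖ / (2 * a) := by
    intro n
    rw [norm_mul, norm_cexp_window_pos, mul_one, norm_div]
    congr 1
    rw [show ((2 : ℂ) * a) = ((2 * a : ℝ) : ℂ) by push_cast; ring, Complex.norm_real,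
      Real.norm_of_nonneg (by positivity)]
  have hs' : Summable fun n : {n // n ∉ modes N} ↦
      ‖fourierCoeff a n φ / (2 * a) * cexp (π * I * n * x / a)‖ := by
    simp_rw [hnorm]
    exact (hsum.div_const (2 * a)).subtype _
  rw [show φ x - trigPoly a N φ x =
      ∑' n : {n // n ∉ modes N}, fourierCoeff a n φ / (2 * a) * cexp (π * I * n * x / a) from
    by rw [hcompl.tsum_eq]; rfl]
  refine (norm_tsum_le_tsum_norm hs').trans (le_of_eq ?_)
  exact tsum_congr fun n ↦ hnorm n

/-- The tails `Σ_{|n| > N} (2a)^{-1}|c_n(φ)|` tend to `0`. [cite: Katznelson2004, Ch. I §6.1 (A(T) ≅ ℓ¹: tails of the norm)] -/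
theorem tendsto_tsum_compl_modes (a : ℝ) (φ : ℝ → ℂ) :
    Tendsto (fun N : ℕ ↦ ∑' n : {n // n ∉ modes N}, ‖fourierCoeff a n φ‖ / (2 * a))
      atTop (𝓝 0) :=
  (tendsto_tsum_compl_atTop_zero fun n : ℤ ↦ ‖fourierCoeff a n φ‖ / (2 * a)).comp
    tendsto_modes_atTop

/-- Uniform bound `‖p_N(x)‖ ≤ Σ_n (2a)^{-1}|c_n(φ)|` (`a > 0`). [cite: Katznelson2004, Ch. I §6.1 (‖f‖_∞ ≤ ‖f‖_{A(T)} = Σ|f̂(n)|)] -/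
theorem norm_trigPoly_le (ha : 0 < a) (hsum : Summable fun n : ℤ ↦ ‖fourierCoeff a n φ‖)
    (N : ℕ) (x : ℝ) :
    ‖trigPoly a N φ x‖ ≤ ∑' n : ℤ, ‖fourierCoeff a n φ‖ / (2 * a) := by
  unfold trigPoly
  refine (norm_sum_le _ _).trans ?_
  have hnorm : ∀ n : ℤ, ‖fourierCoeff a n φ / (2 * a) * cexp (π * I * n * x / a)‖ =
      ‖fourierCoeff a n φ‖ / (2 * a) := by
    intro n
    rw [norm_mul, norm_cexp_window_pos, mul_one, norm_div]
    congr 1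
    rw [show ((2 : ℂ) * a) = ((2 * a : ℝ) : ℂ) by push_cast; ring, Complex.norm_real,
      Real.norm_of_nonneg (by positivity)]
  simp_rw [hnorm]
  exact (hsum.div_const _).sum_le_tsum _ fun n _ ↦ by positivity

/-- `p_N` is differentiable with derivative `p_N'`. [cite: Katznelson2004, Ch. I §1 and Thm 1.6 (trigonometric polynomials; (f′)̂(n) = in·f̂(n))] -/
theorem hasDerivAt_trigPoly (a : ℝ) (N : ℕ) (φ : ℝ → ℂ) (x : ℝ) :
    HasDerivAt (trigPoly a N φ) (trigPolyDeriv a N φ x) x := by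
  unfold trigPoly trigPolyDeriv
  refine HasDerivAt.fun_sum fun n _ ↦ ?_
  have h1 : HasDerivAt (fun y : ℝ ↦ (π * I * n / a) * (y : ℂ)) (π * I * n / a) x := by
    simpa using (Complex.ofRealCLM.hasDerivAt (x := x)).const_mul (π * I * n / a : ℂ)
  have h2 : HasDerivAt (fun y : ℝ ↦ cexp (π * I * n * y / a))
      (cexp (π * I * n * x / a) * (π * I * n / a)) x := by
    have := (Complex.hasDerivAt_exp (π * I * n / a * x)).comp x h1
    have e : ∀ y : ℝ, (π * I * n / a * (y : ℂ) : ℂ) = π * I * n * y / a := fun y ↦ by ring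
    simp_rw [e] at this
    exact this
  exact (h2.const_mul (fourierCoeff a n φ / (2 * a))).congr_deriv (by ring)

/-- Uniform bound for the derivative: `‖p_N'(x)‖ ≤ (π/a)(2a)^{-1} Σ_n |n| |c_n(φ)|` (`a > 0`).
[cite: Katznelson2004, Ch. I Thm 1.6 and §6.1 (‖P′‖_∞ ≤ Σ|n||P̂(n)|)] -/
theorem norm_trigPolyDeriv_le (ha : 0 < a)
    (hsum1 : Summable fun n : ℤ ↦ |(n : ℝ)| ^ 1 * ‖fourierCoeff a n φ‖) (N : ℕ) (x : ℝ) :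
    ‖trigPolyDeriv a N φ x‖ ≤
      (π / a / (2 * a)) * ∑' n : ℤ, |(n : ℝ)| ^ 1 * ‖fourierCoeff a n φ‖ := by
  unfold trigPolyDeriv
  refine (norm_sum_le _ _).trans ?_
  have hnorm : ∀ n : ℤ,
      ‖fourierCoeff a n φ / (2 * a) * (π * I * n / a) * cexp (π * I * n * x / a)‖ =
        (π / a / (2 * a)) * (|(n : ℝ)| ^ 1 * ‖fourierCoeff a n φ‖) := by
    intro n
    rw [norm_mul, norm_cexp_window_pos, mul_one]
    simp only [norm_mul, norm_div, Complex.norm_I, Complex.norm_real, Complex.norm_intCast,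
      Real.norm_eq_abs, Complex.norm_ofNat, pow_one, mul_one]
    rw [abs_of_pos Real.pi_pos, abs_of_pos ha]
    ring
  simp_rw [hnorm]
  rw [← Finset.mul_sum]
  refine mul_le_mul_of_nonneg_left ?_ (by positivity)
  exact hsum1.sum_le_tsum _ fun n _ ↦ by positivity

/-- Lipschitz bound for the core: `‖p_N(y) − p_N(x)‖ ≤ B₁ |y − x|` whenever `‖p_N'‖ ≤ B₁`.
[cite: Katznelson2004, Ch. I Thm 1.6 and §6.1 (mean-value bound ‖P(y) − P(x)‖ ≤ ‖P′‖_∞|y − x|)] -/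
theorem norm_trigPoly_sub_le {N : ℕ} {B₁ : ℝ} (hB : ∀ x, ‖trigPolyDeriv a N φ x‖ ≤ B₁)
    (x y : ℝ) : ‖trigPoly a N φ y - trigPoly a N φ x‖ ≤ B₁ * |y - x| := by
  have h := Convex.norm_image_sub_le_of_norm_deriv_le (f := trigPoly a N φ) (s := univ)
    (fun z _ ↦ (hasDerivAt_trigPoly a N φ z).differentiableAt)
    (fun z _ ↦ by rw [(hasDerivAt_trigPoly a N φ z).deriv]; exact hB z) convex_univ
    (mem_univ x) (mem_univ y)
  rwa [Real.norm_eq_abs] at h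

end Yoshida1992

end Literature.NumberTheory.LFunctions

end
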